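import Summits.BirchSwinnertonDyer.Rank1Residual.X2.RouteGSplitDisplay152880ce1
import Summits.BirchSwinnertonDyer.Rank1Residual.X2.LayerOneRank30576cs1
import HarnessLib

/-!
# Route G at a SPLIT Eisenstein `3`, pair `152880ce1 ← 30576cs1` — the F9 road-T1 display with its layer-1 certificate binder
# DISCHARGED IN THE KERNEL (cell `bsd-eis`, seat `bsd-eis-k5-c3` gen 5; GENERATED by `HOME/k5-c3-g5/gen/gen_wrap.py`; THEOREMS ONLY)

HONEST FRAMING (FULL-BSD rank-≤1 programme D-0033, cell `bsd-eis`, `run/shared/lean/pub/bsd-eis/`; rung K5, crux 3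
`MazurMCOnCellB` = stmt-BirchSwinnertonDyer-19033; row A10-split cell `(152880ce1, 3)`). Nothing booked, no label moves.
`X2/RouteGSplitDisplay152880ce1.lean` (ky g5, planner FINDING F9, cell referee g15 §3 PASS) displays
`X2.MazurMainConjectureAt 152880ce1 3` and `BSDp 152880ce1 3` from the REGISTERED [PUB] facts of token T-EISRG3, the per-pair
instrument certificates `(μ, λ)_an` of target and relative (+ `r_an = 0` for `BSDp`), and ONE further certificate binder
`hm' : LayerRankGEAt W' 3 1 4` («`4 ≤ rank 30576cs1(ℚ₁)`», `ℚ₁ = ℚ(ζ₉)⁺`). That binder is now a THEOREM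
(`LayerOneRank30576cs1.layerRankGEAt_30576cs1`, from `Iwasawa/LayerOneRankGrowth.lean`); this file restates the two displays
WITHOUT it — same names with suffix `_kernel`, every other binder VERBATIM — so the cell's binder census for `(152880ce1, 3)` is
exactly the T-EISRG3 profile (MC: `hWu hpar hT hT' hAm hBm hF` [PUB] + `hμ0 hlam hμ0' hlam'` [instrument]; BSDp: + `hJs hJn
hHs hHn hGZK hmod hGS` [PUB] + `hr` [instrument]). Nothing else changes; nothing booked.
-/

set_option autoImplicit false

noncomputable section

open scoped Classical

open WeierstrassCurve NumberField IsDedekindDomain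
  Literature.NumberTheory.EllipticCurves
  Literature.NumberTheory.EllipticCurves.ModularForms
  Literature.NumberTheory.EllipticCurves.Rank1Residual
  Literature.NumberTheory.EllipticCurves.Rank1Residual.Typed
  Literature.NumberTheory.EllipticCurves.Rank1Residual.X11RankOneCertificates
  Literature.NumberTheory.EllipticCurves.Wuthrich2014
  Literature.NumberTheory.EllipticCurves.SteinWuthrich2013
  Literature.NumberTheory.EllipticCurves.Greenberg1999
  Literature.NumberTheory.EllipticCurves.GreenbergVatsal2000
  Summit.BirchSwinnertonDyer.BirchSwinnertonDyer.Rank1Residual.IntModel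
  Summit.BirchSwinnertonDyer.BirchSwinnertonDyer.Rank1Residual.X11RankOne
  Summit.BirchSwinnertonDyer.Rank1Residual.X11b
  Summit.BirchSwinnertonDyer.Rank1Residual.X1.CongruenceTransfer
  Summit.BirchSwinnertonDyer.Rank1Residual.X2.LocalDeltaCalculus
  Summit.BirchSwinnertonDyer.Rank1Residual
  Summit.BirchSwinnertonDyer.Rank1Residual.X2.RouteGSplitDisplay152880ce1Local
  Summit.BirchSwinnertonDyer.Rank1Residual.Iwasawa


namespace Summit.BirchSwinnertonDyer.Rank1Residual.X2.RouteGSplitDisplay152880ce1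

/-- **`X2.MazurMainConjectureAt 152880ce1 3` — the F9 road-T1 display with `hm'` discharged** (`LayerOneRank30576cs1.layerRankGEAt_30576cs1`):
binders = T-EISRG3's MC facts + the instrument certificates `hμ0 hlam hμ0' hlam'`. [cite: GreenbergVatsal2000, Thm. (1.4), §2 Prop. (2.4)]
[cite: Wuthrich2014, Thm. 16 (p. 397)] [cite: GreenbergLNM1716, Thm. 1.9 (p. 63)] -/
theorem mazurMainConjectureAt_152880ce1_at_three_kernel
    (hWu : thm16_charIdeal_dvd_multiplicative_of_reducible)
    (hpar : nonempty_modularParametrizationData)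
    (hT : Silverman1994_thmV53_corV54_tateUniformisation.{0})
    (hT' : Silverman1994_thmV53_tateUniformisation.{0})
    (hAm : lambda_nonPrimitive_eq_add_sum_delta_multiplicative)
    (hBm : datumSelmer_divisible_of_finite_torsionBy) (hF : datumStrictSelmer_lt_datumSelmer_of_split)
    (W W' : WeierstrassCurve ℚ) [W.IsElliptic] [W.IsGloballyMinimal] [W'.IsElliptic]
    [W'.IsGloballyMinimal] (hW : W = ⟨0, 1, 0, -51221, -11739645⟩)
    (hW' : W' = ⟨0, 1, 0, -352, 4724⟩)
    (hμ0 : AnalyticMuLE W 3 0) (hlam : AnalyticLambdaEq W 3 5)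
    (hμ0' : AnalyticMuLE W' 3 0) (hlam' : AnalyticLambdaEq W' 3 5) :
    X2.MazurMainConjectureAt W 3 :=
  mazurMainConjectureAt_152880ce1_at_three hWu hpar hT hT' hAm hBm hF W W' hW hW' (by subst hW'; exact LayerOneRank30576cs1.layerRankGEAt_30576cs1) hμ0 hlam hμ0' hlam'

/-- **`BSD(152880ce1, 3)` — the F9 road-T1 display with `hm'` discharged** (`LayerOneRank30576cs1.layerRankGEAt_30576cs1`): binders =
T-EISRG3's BSDp facts + `hGS` + the instrument certificates `hr hμ0 hlam hμ0' hlam'`. [cite: GreenbergVatsal2000, Thm. (1.4), §2 Prop. (2.4)]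
[cite: Wuthrich2014, Thm. 16 (p. 397)] [cite: SteinWuthrich2013, Thm. 6.1 (p. 20)] [cite: GreenbergLNM1716, Thm. 1.9 (p. 63)] -/
theorem bsdp_152880ce1_at_three_kernel
    (hWu : thm16_charIdeal_dvd_multiplicative_of_reducible)
    (hJs : thm61_splitMultiplicative) (hJn : thm61_nonsplitMultiplicative)
    (hHs : exists_isSplitMultCanonical) (hHn : exists_isMultCanonical)
    (hGZK : rank_eq_analyticRank_of_analyticRank_le_one) (hmod : hasEntireLFunction_rat)
    (hpar : nonempty_modularParametrizationData)
    (hT : Silverman1994_thmV53_corV54_tateUniformisation.{0})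
    (hT' : Silverman1994_thmV53_tateUniformisation.{0})
    (hAm : lambda_nonPrimitive_eq_add_sum_delta_multiplicative)
    (hBm : datumSelmer_divisible_of_finite_torsionBy) (hF : datumStrictSelmer_lt_datumSelmer_of_split)
    (W W' : WeierstrassCurve ℚ) [W.IsElliptic] [W.IsGloballyMinimal] [W'.IsElliptic]
    [W'.IsGloballyMinimal] (hW : W = ⟨0, 1, 0, -51221, -11739645⟩)
    (hW' : W' = ⟨0, 1, 0, -352, 4724⟩)
    (hGS : greenberg_stevens (W := W) (p := 3))
    (hr : W.analyticRank = 0)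
    (hμ0 : AnalyticMuLE W 3 0) (hlam : AnalyticLambdaEq W 3 5)
    (hμ0' : AnalyticMuLE W' 3 0) (hlam' : AnalyticLambdaEq W' 3 5) :
    BSDp W 3 :=
  bsdp_152880ce1_at_three hWu hJs hJn hHs hHn hGZK hmod hpar hT hT' hAm hBm hF W W' hW hW' hGS hr (by subst hW'; exact LayerOneRank30576cs1.layerRankGEAt_30576cs1) hμ0 hlam hμ0' hlam'

end Summit.BirchSwinnertonDyer.Rank1Residual.X2.RouteGSplitDisplay152880ce1

end
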